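import Summits.ResolutionOfSingularities.ResolutionOfSingularities.Theses.SectionAscent
import Literature.AlgebraicGeometry.Resolution.BlowupsExistence
import Literature.AlgebraicGeometry.Resolution.Temkin2008Localization
import Literature.AlgebraicGeometry.Motives.Varieties

/-!
# `AffineToGlobal` — negative lemmas III: the guards of the weak-frame residue
# `stub_isolatingBlowup` (line `birth`, reshape 3) are load-bearing, and only they are cheap

Support (negative-side) lemmas for crux `stmt-ResolutionOfSingularities-15961`
(`Summit.ResolutionOfSingularities.ResolutionOfSingularities.Theses.SectionAscent.AffineToGlobal`),
filed by the crux disprover (cdisprove, gen 2, 2026-08-17) against the lead's reshape-3 skeleton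
`Cruxes/AffineToGlobal/Lines/birth.lean`, whose open weak-frame residue is

  `stub_isolatingBlowup`: under affine one-shots, every integral closed `X ⊆ ℙⁿ_K` admits a
  blow-up `π₁ : X₁ → X` along an ideal sheaf `J₁ ≠ ⊥` with `(Reg X₁)ᶜ` finite.

The stub cannot be refuted outright (its hypothesis is strong resolution in characteristic `p`),
so this file records, as kernel-checked facts, which parts of its CONCLUSION SHAPE carry content:

* `exists_isBlowup_finite_compl_regularLocus` — **without `J₁ ≠ ⊥` the conclusion is vacuous on
  every scheme**: the blow-up along the zero ideal sheaf is the empty scheme (tree: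
  `IsBlowup.isEmpty_of_bot`), which has no non-regular points. So `J₁ ≠ ⊥` is the conclusion's
  only guard against junk, and any proof must produce a genuinely nonzero centre.
* `idealSheafData_eq_bot_of_isEmpty`, `isolatingBlowupShape_false_without_isIntegral` — **without
  `IsIntegral X` the conclusion is false**: the empty scheme is a closed subscheme of `ℙⁿ_K` and
  carries no ideal sheaf `≠ ⊥`. Integrality (through non-emptiness) is load-bearing, not
  decoration; a prover may not weaken it to "reduced".
* `top_ne_bot_idealSheafData`, `isolatingBlowupShape_of_finite` — **where the non-regular locus is
  already finite the conclusion holds by the identity** (`J₁ = ⊤`, tree: `isBlowup_id_top`): the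
  stub's entire content sits at projective varieties with a positive-dimensional singular locus
  (so not at curves, nor at normal surfaces) — the same locus the lead's `KERNEL-2.md` §3
  isolates as unreachable from affine one-shots.

No definition is declared; no declaration concludes a route decl positively.

## Sources
* M. Temkin, Adv. Math. 219 (2008), Def. 2.2.6 (`Bl_X(X) = ∅`), as proved in the tree.
* U. Görtz, T. Wedhorn, *Algebraic Geometry I*, (13.19) (the identity blows up the empty
  subscheme), as proved in the tree.
-/

noncomputable section

set_option linter.dupNamespace false -- mandated namespace of this single-conjunct summit

open CategoryTheory CategoryTheory.Limits AlgebraicGeometry TopologicalSpace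
open Literature.AlgebraicGeometry.Resolution
open Summit.ResolutionOfSingularities.ResolutionOfSingularities.Theses.SectionAscent (AffineToGlobal)

namespace Summit.ResolutionOfSingularities.ResolutionOfSingularities.Theorems.AffineToGlobal.Negative

universe u

/-! ## Without `J₁ ≠ ⊥` the conclusion is vacuous -/

/-- **Every scheme has a blow-up with finitely many non-regular points — along the zero ideal
sheaf, with empty source.** Hence the conjunct `J₁ ≠ ⊥` is the only thing that keeps the
conclusion of `stub_isolatingBlowup` honest. [cite: Temkin2008, Def. 2.2.6] -/
theorem exists_isBlowup_finite_compl_regularLocus (X : Scheme.{u}) :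
    ∃ (X₁ : Scheme.{u}) (π₁ : X₁ ⟶ X) (J₁ : X.IdealSheafData),
      IsBlowup π₁ J₁ ∧ (Scheme.regularLocus X₁)ᶜ.Finite := by
  obtain ⟨X₁, π₁, h⟩ := exists_isBlowup X ⊥
  haveI := h.isEmpty_of_bot
  exact ⟨X₁, π₁, ⊥, h, Set.toFinite _⟩

/-! ## Without `IsIntegral X` the conclusion is false (the empty closed subscheme) -/

/-- On a scheme without points every ideal sheaf is the zero ideal sheaf (all rings of sections
are zero rings). [folklore] -/
theorem idealSheafData_eq_bot_of_isEmpty (X : Scheme.{u}) [IsEmpty X] (J : X.IdealSheafData) :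
    J = ⊥ := by
  apply Scheme.IdealSheafData.ext
  funext U
  have hU : (U : X.Opens) = ⊥ := by
    ext x
    exact (IsEmpty.false x).elim
  haveI : Subsingleton Γ(X, U) :=
    CommRingCat.subsingleton_of_isTerminal (X.sheaf.isTerminalOfEqEmpty hU)
  ext x
  rw [Subsingleton.elim x 0]
  exact ⟨fun _ => zero_mem _, fun _ => zero_mem _⟩

/-- **`IsIntegral X` is load-bearing in `stub_isolatingBlowup`**: dropping it (keeping the closed
immersion into `ℙⁿ_K`) makes the conclusion false, witnessed by the EMPTY closed subscheme of
`ℙⁿ_K`, which carries no ideal sheaf `≠ ⊥`. Stated for every field `K` and every `n`; no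
hypothesis of the crux is involved. [folklore] -/
theorem isolatingBlowupShape_false_without_isIntegral (K : Type) [Field K] (n : ℕ) :
    ¬ ∀ (X : Scheme.{0})
        (ι : X ⟶ (Literature.AlgebraicGeometry.Motives.projectiveSpace n K).left),
        IsClosedImmersion ι →
        ∃ (X₁ : Scheme.{0}) (π₁ : X₁ ⟶ X) (J₁ : X.IdealSheafData),
          J₁ ≠ ⊥ ∧ IsBlowup π₁ J₁ ∧ (Scheme.regularLocus X₁)ᶜ.Finite := by
  intro h
  obtain ⟨X₁, π₁, J₁, hJ₁, -, -⟩ := h ∅ (Scheme.emptyTo _) inferInstance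
  exact hJ₁ (idealSheafData_eq_bot_of_isEmpty ∅ J₁)

/-! ## Where the non-regular locus is finite the conclusion is free -/

/-- On a scheme with a point, the unit ideal sheaf is not the zero ideal sheaf. [folklore] -/
theorem top_ne_bot_idealSheafData (X : Scheme.{u}) [Nonempty X] :
    (⊤ : X.IdealSheafData) ≠ ⊥ := by
  obtain ⟨x⟩ := (inferInstance : Nonempty X)
  obtain ⟨U, hU, hxU, -⟩ :=
    exists_isAffineOpen_mem_and_subset (X := X) (x := x) (U := ⊤) (Opens.mem_top x)
  haveI : Nontrivial Γ(X, U) := (X.evaluation U x hxU).hom.domain_nontrivial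
  intro h
  have h1 := congrArg (fun J : X.IdealSheafData => J.ideal ⟨U, hU⟩) h
  simp only [Scheme.IdealSheafData.ideal_top, Scheme.IdealSheafData.ideal_bot, Pi.top_apply,
    Pi.bot_apply] at h1
  exact top_ne_bot h1

/-- **Where `(Reg X)ᶜ` is already finite, the conclusion of `stub_isolatingBlowup` holds by the
identity** (the blow-up along the unit ideal sheaf). So the stub has content only at schemes
with an infinite (positive-dimensional) non-regular locus. [cite: GortzWedhorn2020, (13.19)] -/
theorem isolatingBlowupShape_of_finite (X : Scheme.{u}) [Nonempty X]
    (hfin : (Scheme.regularLocus X)ᶜ.Finite) :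
    ∃ (X₁ : Scheme.{u}) (π₁ : X₁ ⟶ X) (J₁ : X.IdealSheafData),
      J₁ ≠ ⊥ ∧ IsBlowup π₁ J₁ ∧ (Scheme.regularLocus X₁)ᶜ.Finite :=
  ⟨X, 𝟙 X, ⊤, top_ne_bot_idealSheafData X, isBlowup_id_top X, hfin⟩

/-- In particular a REGULAR scheme with a point satisfies the conclusion with the identity
(empty non-regular locus). [folklore] -/
theorem isolatingBlowupShape_of_isRegular (X : Scheme.{u}) [Nonempty X]
    (hX : Scheme.IsRegular X) :
    ∃ (X₁ : Scheme.{u}) (π₁ : X₁ ⟶ X) (J₁ : X.IdealSheafData),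
      J₁ ≠ ⊥ ∧ IsBlowup π₁ J₁ ∧ (Scheme.regularLocus X₁)ᶜ.Finite := by
  refine isolatingBlowupShape_of_finite X ?_
  have : (Scheme.regularLocus X)ᶜ = ∅ :=
    Set.compl_empty_iff.mpr (Set.eq_univ_of_forall fun x => hX x)
  rw [this]
  exact Set.finite_empty

end Summit.ResolutionOfSingularities.ResolutionOfSingularities.Theorems.AffineToGlobal.Negative

end
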